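import Summits.AtomisticToContinuum.HydrodynamicLimit.Theses.InformationPercolationEngine
import Summits.AtomisticToContinuum.HydrodynamicLimit.Theorems.InformationPercolationEngineKickFairRelEquilibriumMesoCutCoreB
import Summits.AtomisticToContinuum.HydrodynamicLimit.Theorems.InformationPercolationEngineKickFairRelEquilibriumMesoPinchTransfer
import Summits.AtomisticToContinuum.HydrodynamicLimit.Theorems.InformationPercolationEngineKickFairRelEquilibriumMesoBinOscillation
import Summits.AtomisticToContinuum.HydrodynamicLimit.Theorems.InformationPercolationEngineKickFairRelEquilibriumMesoKeyCount
import Summits.AtomisticToContinuum.HydrodynamicLimit.Theorems.InformationPercolationEngineKickFairRelEquilibriumMesoEnergyTail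
import Summits.AtomisticToContinuum.HydrodynamicLimit.Theorems.InformationPercolationEngineKickFairRelEquilibriumMesoPastMeasurable
import HarnessLib

/-!
# `KickFairRelEquilibriumMeso`, line `Sketch` — glue T′ `cutTransfer` (rev 7/8, the SHORT-FLIGHT CUT): final assembly

Prover file of the line lead: the glue of the skeleton `Cruxes/KickFairRelEquilibriumMeso/Lines/Sketch.lean` rev 8,
discharging the registered stub `stub_cutTransfer`. From the landed stubs S0′ `stub_binOscillation`, KC `stub_keyCount`,
E2 `stub_energyTail`, M `stub_pastMeasurable`, G1 `stub_cutCount` (inside parts 1–2) and the four hypotheses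
O (integrability of the windowed kick sums under the invariant law — landed, `stub_slotSumIntegrable`),
U (`stub_shortFlightLG`: the `LG`-mean of the normalised number of short-flight collisions is small),
R-i″ (`stub_restartBiasCut`) and R-ii″ (`stub_restartConcentrationCut`) — restart bias and concentration for CUT weight
families on `LG`-typical level sets of the time-zero key — the crux
`Summit.AtomisticToContinuum.HydrodynamicLimit.Theses.InformationPercolationEngine.KickFairRelEquilibriumMeso` follows with
`rs N = (N+1)^{-1/4}`.

Proof: `σ₀ = min (1/2) (min σ_O (min σ_U (min σ_{R-i″} σ_{R-ii″})))`; given `σ, Φ, τ, g (|g| ≤ C_g), δ`: `A` from U at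
`δ/(8(C_g+1))`; CUT the weights, `h' = h·1{flight ≥ t_N/A}` (admissible and cut, `cut_admissible`), so that
`E_LG|S_h| ≤ E_LG|S_{h'}| + 2C_g E_LG W_sf(A) ≤ E_LG|S_{h'}| + δ/4` (`abs_fullSum_sub_cut_le`); then `δ′ = δ/(8(τ+1))`,
`L = 8(τ+1)/δ`, `η₁, c, η₂` from R-i″/R-ii″ at `(δ′, A)` / `(L, A)`, `η = min η₁ η₂`, `θ₁, Λ` from the global domination,
`K₀` from E2 at rate `log Λ + 1`, `ηp (1 + 2(K₀+1)) = κ₁ = min c 1 / 4` for S0′ (twice), keys from KC, and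
`cut_core_estimate` for `h'`: its bound is `m(δ′+1/L)t_N ≤ δ/4` plus three terms `e^{κ₁(N+1)−c(N+1)}`,
`e^{C_K(N+1)^{3/4}log(N+2) − η(N+1)}`, `e^{-(N+1)}` times constants (`cutErrorTerm_tendsto`), `≤ δ/4` eventually.
Necklace-proof: no tail of the collision count under any law is used (cf. `NecklaceE1R2False.md`).
-/

noncomputable section

open MeasureTheory Set Filter Topology
open scoped ENNReal Classical

namespace Summit.AtomisticToContinuum.HydrodynamicLimit.Theorems.KickFairRelEquilibriumMesoLine

open Literature.Analysis.FluidPDE Literature.MathematicalPhysics.KineticTheory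
open Summit.AtomisticToContinuum.HydrodynamicLimit.Theorems

variable {σ : ℝ} {N : ℕ}

/-! ## Small inputs -/

/-- `ε_N = σ t_N`. [folklore] -/
theorem hsDiameter_eq_mul_tN (σ : ℝ) (N : ℕ) : hsDiameter σ N = σ * tN N := by
  unfold hsDiameter tN
  push_cast
  ring_nf

/-- **The error term of the cut glue tends to zero**: `e^{κ(N+1)} e^{-c(N+1)}` (`κ < c`),
`e^{C_K (N+1)^{3/4} log(N+2)} e^{-η(N+1)}`, `e^{-(N+1)}`, times constants. [folklore] -/
theorem cutErrorTerm_tendsto (A₁ A₂ CK : ℝ) {c η κ : ℝ} (hκc : κ < c) (hη : 0 < η) :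
    Tendsto (fun N : ℕ =>
      A₁ * (Real.exp (κ * ((N : ℝ) + 1)) * Real.exp (-(c * ((N : ℝ) + 1)))) +
      Real.exp (CK * ((N : ℝ) + 1) ^ (3 / 4 : ℝ) * Real.log ((N : ℝ) + 2)) * (A₂ * Real.exp (-(η * ((N : ℝ) + 1)))) +
      A₂ * Real.exp (-((N : ℝ) + 1))) atTop (𝓝 0) := by
  have P1 : Tendsto (fun N : ℕ => Real.exp (κ * ((N : ℝ) + 1)) * Real.exp (-(c * ((N : ℝ) + 1)))) atTop (𝓝 0) := by
    refine (tendsto_exp_keyEntropy_sub 0 (sub_pos.2 hκc)).congr fun N => ?_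
    rw [← Real.exp_add]; congr 1; ring
  have P2 : Tendsto (fun N : ℕ => Real.exp (CK * ((N : ℝ) + 1) ^ (3 / 4 : ℝ) * Real.log ((N : ℝ) + 2)) *
      (A₂ * Real.exp (-(η * ((N : ℝ) + 1))))) atTop (𝓝 0) := by
    have := (tendsto_exp_keyEntropy_sub CK hη).const_mul A₂
    rw [mul_zero] at this
    refine this.congr fun N => ?_
    rw [sub_eq_add_neg, Real.exp_add]; ring
  have P3 := tendsto_exp_neg_succ.const_mul A₂
  have tot := ((P1.const_mul A₁).add P2).add P3
  simpa only [mul_zero, add_zero, zero_add] using tot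

/-- **A.e.-measurability of the normalised short-flight count** under every law charging only the good set: it
agrees there with its good-set-guarded version, which is measurable by the plumbing M. [folklore] -/
theorem aemeasurable_shortFn (hM : PastMeasurable) (hσ : 0 < σ) (Φ : Flow σ N) (τ r A : ℝ)
    {μ : Measure (Phase N)} (hμ : μ Φ.goodᶜ = 0) :
    AEMeasurable (fun z => hsDiameter σ N / ((N : ℝ) + 1) *
      ∑ i : Fin (N + 1), ∑ n ∈ Finset.range (cnt Φ τ z i),
        (if (past Φ r z i n).2.2.2 - (past Φ r z i n).2.1 < tN N / A then (1 : ℝ) else 0)) μ := by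
  set F : Fin (N + 1) → ℕ → Phase N → ℝ := fun i n z =>
    (if (past Φ r z i n).2.2.2 - (past Φ r z i n).2.1 < tN N / A then (1 : ℝ) else 0) with hF
  have hFm : ∀ i n, Measurable (F i n) := by
    intro i n
    have hP : Measurable (fun z => past Φ r z i n) := (hM σ hσ N Φ r 0 i n).1
    have hfl : Measurable (fun z => (past Φ r z i n).2.2.2 - (past Φ r z i n).2.1) :=
      (measurable_snd.comp (measurable_snd.comp (measurable_snd.comp hP))).sub
        (measurable_fst.comp (measurable_snd.comp hP))
    exact Measurable.ite (measurableSet_lt hfl measurable_const) measurable_const measurable_const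
  set G : Phase N → ℝ := fun z => hsDiameter σ N / ((N : ℝ) + 1) *
    ∑ i : Fin (N + 1), ∑ n ∈ Finset.range (gcnt Φ τ z i), F i n z with hG
  have hGm : Measurable G := by
    refine Measurable.const_mul (Finset.measurable_sum _ fun i _ => ?_) _
    exact measurable_sum_range_of_measurable (fun n => hFm i n) (measurable_gcnt hM hσ Φ τ i)
  refine hGm.aemeasurable.congr ?_
  filter_upwards [(mem_ae_iff.2 hμ : ∀ᵐ z ∂μ, z ∈ Φ.good)] with z hz
  simp only [hG, gcnt, hz, if_true, hF]

/-! ## The glue -/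

/-- **The glue of the line, `cutTransfer` (rev 7/8; it discharges the skeleton's glue stub `stub_cutTransfer`).**
See the module docstring. -/
theorem cutTransfer :
    (∃ σ₀ : ℝ, 0 < σ₀ ∧ ∀ σ : ℝ, 0 < σ → σ < σ₀ → ∀ N : ℕ, 1 ≤ N → ∀ Φ : Flow σ N, ∀ τ r t₁ t₂ : ℝ,
      ∀ g : V3 × V3 × V3 → ℝ, Continuous g → (∃ C : ℝ, ∀ p, |g p| ≤ C) →
      ∀ h : Fin (N + 1) → ℕ → Past N → ℝ, (∀ i n, Measurable (h i n)) → (∀ i n p, |h i n p| ≤ 1) →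
      Integrable (slotSum Φ τ r t₁ t₂ g h) (localGibbsLaw σ (fun _ => 1) (fun _ => 0) (fun _ => 1) N Φ)) →
    (∀ (a₀ θ₀ : T3 → ℝ) (u₀ : T3 → V3), Continuous a₀ → Continuous θ₀ → Continuous u₀ →
      (∀ x, 0 < a₀ x) → (∀ x, 0 < θ₀ x) →
      ∃ σ₀ : ℝ, 0 < σ₀ ∧ ∀ σ : ℝ, 0 < σ → σ < σ₀ → ∀ Φ : (N : ℕ) → Flow σ N, ∀ τ : ℝ, 0 < τ →
      ∀ δ : ℝ, 0 < δ → ∃ A : ℝ, 0 < A ∧ ∃ N₀ : ℕ, ∀ N : ℕ, N₀ ≤ N →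
      ∫⁻ z, ENNReal.ofReal (hsDiameter σ N / ((N : ℝ) + 1) *
          ∑ i : Fin (N + 1), ∑ n ∈ Finset.range (cnt (Φ N) τ z i),
            (if (past (Φ N) (rs N) z i n).2.2.2 - (past (Φ N) (rs N) z i n).2.1 < tN N / A then (1 : ℝ) else 0))
          ∂(localGibbsLaw σ a₀ u₀ θ₀ N (Φ N)) ≤ ENNReal.ofReal δ) →
    (∀ (a₀ θ₀ : T3 → ℝ) (u₀ : T3 → V3), Continuous a₀ → Continuous θ₀ → Continuous u₀ →
      (∀ x, 0 < a₀ x) → (∀ x, 0 < θ₀ x) →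
      ∃ σ₀ : ℝ, 0 < σ₀ ∧ ∀ σ : ℝ, 0 < σ → σ < σ₀ → ∀ Φ : (N : ℕ) → Flow σ N, ∀ τ : ℝ, 0 < τ →
      ∀ g : V3 × V3 × V3 → ℝ, Continuous g → (∃ C : ℝ, ∀ p, |g p| ≤ C) →
      ∀ δ : ℝ, 0 < δ → ∀ A : ℝ, 0 < A →
      ∃ η : ℝ, 0 < η ∧ ∃ N₀ : ℕ, ∀ N : ℕ, N₀ ≤ N →
      ∀ h : Fin (N + 1) → ℕ → Past N → ℝ, (∀ i n, Measurable (h i n)) → (∀ i n p, |h i n p| ≤ 1) →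
      (∀ i n p, p.2.2.2 - p.2.1 < tN N / A → h i n p = 0) →
      ∀ t₁ t₂ : ℝ, 0 ≤ t₁ → t₁ ≤ t₂ → t₂ ≤ τ → t₂ ≤ t₁ + tN N →
      ∀ z₀ : Phase N,
      ENNReal.ofReal (Real.exp (-(η * ((N : ℝ) + 1)))) ≤
          localGibbsLaw σ a₀ u₀ θ₀ N (Φ N) {z | cellKey (rs N) (rs N) z = cellKey (rs N) (rs N) z₀} →
        |∫ z in {z | cellKey (rs N) (rs N) z = cellKey (rs N) (rs N) z₀}, slotSum (Φ N) τ (rs N) t₁ t₂ g h z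
            ∂(localGibbsLaw σ (fun _ => 1) (fun _ => 0) (fun _ => 1) N (Φ N))| ≤
          δ * tN N * (localGibbsLaw σ (fun _ => 1) (fun _ => 0) (fun _ => 1) N (Φ N)
            {z | cellKey (rs N) (rs N) z = cellKey (rs N) (rs N) z₀}).toReal) →
    (∀ (a₀ θ₀ : T3 → ℝ) (u₀ : T3 → V3), Continuous a₀ → Continuous θ₀ → Continuous u₀ →
      (∀ x, 0 < a₀ x) → (∀ x, 0 < θ₀ x) →
      ∃ σ₀ : ℝ, 0 < σ₀ ∧ ∀ σ : ℝ, 0 < σ → σ < σ₀ → ∀ Φ : (N : ℕ) → Flow σ N, ∀ τ : ℝ, 0 < τ →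
      ∀ g : V3 × V3 × V3 → ℝ, Continuous g → (∃ C : ℝ, ∀ p, |g p| ≤ C) →
      ∀ L : ℝ, 0 < L → ∀ A : ℝ, 0 < A →
      ∃ c : ℝ, 0 < c ∧ ∃ η : ℝ, 0 < η ∧ ∃ N₀ : ℕ, ∀ N : ℕ, N₀ ≤ N →
      ∀ h : Fin (N + 1) → ℕ → Past N → ℝ, (∀ i n, Measurable (h i n)) → (∀ i n p, |h i n p| ≤ 1) →
      (∀ i n p, p.2.2.2 - p.2.1 < tN N / A → h i n p = 0) →
      ∀ t₁ t₂ : ℝ, 0 ≤ t₁ → t₁ ≤ t₂ → t₂ ≤ τ → t₂ ≤ t₁ + tN N →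
      ∀ z₀ : Phase N,
      ENNReal.ofReal (Real.exp (-(η * ((N : ℝ) + 1)))) ≤
          localGibbsLaw σ a₀ u₀ θ₀ N (Φ N) {z | cellKey (rs N) (rs N) z = cellKey (rs N) (rs N) z₀} →
        localGibbsLaw σ (fun _ => 1) (fun _ => 0) (fun _ => 1) N (Φ N)
            ({z | cellKey (rs N) (rs N) z = cellKey (rs N) (rs N) z₀} ∩
              {z | tN N / L < |slotSum (Φ N) τ (rs N) t₁ t₂ g h z -
                (localGibbsLaw σ (fun _ => 1) (fun _ => 0) (fun _ => 1) N (Φ N)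
                    {z | cellKey (rs N) (rs N) z = cellKey (rs N) (rs N) z₀}).toReal⁻¹ *
                  ∫ z in {z | cellKey (rs N) (rs N) z = cellKey (rs N) (rs N) z₀}, slotSum (Φ N) τ (rs N) t₁ t₂ g h z
                    ∂(localGibbsLaw σ (fun _ => 1) (fun _ => 0) (fun _ => 1) N (Φ N))|}) ≤
          ENNReal.ofReal (Real.exp (-(c * ((N : ℝ) + 1)))) *
            localGibbsLaw σ (fun _ => 1) (fun _ => 0) (fun _ => 1) N (Φ N)
              {z | cellKey (rs N) (rs N) z = cellKey (rs N) (rs N) z₀}) →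
    Summit.AtomisticToContinuum.HydrodynamicLimit.Theses.InformationPercolationEngine.KickFairRelEquilibriumMeso := by
  intro hO hU hB hC
  refine ⟨rs, rs_admissible.1, rs_admissible.2.1, rs_admissible.2.2, ?_⟩
  intro a₀ θ₀ u₀ ha hθ hu ha0 hθ0
  obtain ⟨θ₁, hθ₁, Λ, hΛ, hdomAll⟩ := exists_localGibbsMeasure_le_smul_const ha hθ hu ha0 hθ0
  obtain ⟨σO, hσO, hOall⟩ := hO
  obtain ⟨σU, hσU, hUall⟩ := hU a₀ θ₀ u₀ ha hθ hu ha0 hθ0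
  obtain ⟨σB, hσB, hBall⟩ := hB a₀ θ₀ u₀ ha hθ hu ha0 hθ0
  obtain ⟨σC, hσC, hCall⟩ := hC a₀ θ₀ u₀ ha hθ hu ha0 hθ0
  refine ⟨min (1 / 2) (min σO (min σU (min σB σC))),
    lt_min (by norm_num) (lt_min hσO (lt_min hσU (lt_min hσB hσC))), ?_⟩
  intro σ hσ hσlt Φ τ hτ g hg hgb δ hδ
  have hσ12 : σ < 1 / 2 := hσlt.trans_le (min_le_left _ _)
  have hσ2 : σ ≤ 1 / 2 := hσ12.le
  have hσrest : σ < min σO (min σU (min σB σC)) := hσlt.trans_le (min_le_right _ _)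
  have hσO' : σ < σO := hσrest.trans_le (min_le_left _ _)
  have hσU' : σ < σU := hσrest.trans_le ((min_le_right _ _).trans (min_le_left _ _))
  have hσB' : σ < σB := hσrest.trans_le ((min_le_right _ _).trans ((min_le_right _ _).trans (min_le_left _ _)))
  have hσC' : σ < σC := hσrest.trans_le ((min_le_right _ _).trans ((min_le_right _ _).trans (min_le_right _ _)))
  obtain ⟨Cg, hCg⟩ := hgb
  have hCg0 : 0 ≤ Cg := (abs_nonneg _).trans (hCg 0)
  have hCg2 : (0 : ℝ) ≤ 2 * Cg := by positivity
  -- the cut level from U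
  obtain ⟨A, hA, NU, hUN⟩ := hUall σ hσ hσU' Φ τ hτ (δ / (8 * (Cg + 1))) (by positivity)
  -- the bias target and the relative deviation
  set δ' : ℝ := δ / (8 * (τ + 1)) with hδ'
  set L : ℝ := 8 * (τ + 1) / δ with hLdef
  have hδ'0 : 0 < δ' := by positivity
  have hL0 : 0 < L := by positivity
  have hbudget : (τ + 1) * (δ' + 1 / L) = δ / 4 := by
    rw [hδ', hLdef]; field_simp; ring
  -- R-i″ and R-ii″ at the cut level
  obtain ⟨η₁, hη₁, NB, hBN⟩ := hBall σ hσ hσB' Φ τ hτ g hg ⟨Cg, hCg⟩ δ' hδ'0 A hA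
  obtain ⟨c, hc, η₂, hη₂, NC, hCN⟩ := hCall σ hσ hσC' Φ τ hτ g hg ⟨Cg, hCg⟩ L hL0 A hA
  set η : ℝ := min η₁ η₂ with hηdef
  have hη : 0 < η := lt_min hη₁ hη₂
  -- E2 at rate log Λ + 1
  have hlogΛ : 0 ≤ Real.log Λ := Real.log_nonneg hΛ
  obtain ⟨K, NE2, hE2N⟩ := stub_energyTail θ₁ hθ₁ (Real.log Λ + 1) (by positivity)
  set K₀ : ℝ := max K 0 with hK₀
  have hK₀0 : 0 ≤ K₀ := le_max_right _ _
  -- S0′ twice, with tolerance ηp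
  set κ₁ : ℝ := min c 1 / 4 with hκ₁
  set ηp : ℝ := κ₁ / (1 + 2 * (K₀ + 1)) with hηp
  have hκ₁0 : 0 < κ₁ := by rw [hκ₁]; exact div_pos (lt_min hc one_pos) (by norm_num)
  have hκ₁c : κ₁ < c := by
    rw [hκ₁]
    have : min c 1 ≤ c := min_le_left _ _
    linarith
  have hηp0 : 0 < ηp := by rw [hηp]; exact div_pos hκ₁0 (by positivity)
  have hηpκ : ηp * (1 + 2 * (K₀ + 1)) = κ₁ := by rw [hηp]; field_simp
  obtain ⟨NS1, hS1⟩ := stub_binOscillation a₀ θ₀ u₀ ha hθ hu ha0 hθ0 ηp hηp0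
  obtain ⟨NS2, hS2⟩ := stub_binOscillation (fun _ => 1) (fun _ => θ₁) (fun _ => 0) continuous_const continuous_const
    continuous_const (fun _ => one_pos) (fun _ => hθ₁) ηp hηp0
  -- KC
  obtain ⟨CK, hKCall⟩ := stub_keyCount K₀ hK₀0
  -- the error term and its limit
  set β₁ : ℝ := 2 * Cg * (A + 1) * σ * (τ + 1) with hβ₁
  have hβ₁0 : 0 ≤ β₁ := by positivity
  obtain ⟨NA, hNA⟩ : ∃ NA : ℕ, ∀ N, NA ≤ N →
      (τ + 1) * (2 * Cg * (A + 1) * σ + δ') * (Real.exp (κ₁ * ((N : ℝ) + 1)) * Real.exp (-(c * ((N : ℝ) + 1)))) +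
      Real.exp (CK * ((N : ℝ) + 1) ^ (3 / 4 : ℝ) * Real.log ((N : ℝ) + 2)) * (β₁ * Real.exp (-(η * ((N : ℝ) + 1)))) +
      β₁ * Real.exp (-((N : ℝ) + 1)) ≤ δ / 4 := by
    have hlim := cutErrorTerm_tendsto ((τ + 1) * (2 * Cg * (A + 1) * σ + δ')) β₁ CK hκ₁c hη
    have := hlim.eventually (gt_mem_nhds (by positivity : (0 : ℝ) < δ / 4))
    obtain ⟨NA, hNA⟩ := eventually_atTop.1 this
    exact ⟨NA, fun N hN => (hNA N hN).le⟩
  refine ⟨max (max NU (max NB NC)) (max (max NE2 NS1) (max NS2 NA)), fun N hN h hh hhb => ?_⟩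
  have hNU : NU ≤ N := le_trans ((le_max_left _ _).trans (le_max_left _ _)) hN
  have hNB : NB ≤ N := le_trans (((le_max_left _ _).trans (le_max_right _ _)).trans (le_max_left _ _)) hN
  have hNC : NC ≤ N := le_trans (((le_max_right _ _).trans (le_max_right _ _)).trans (le_max_left _ _)) hN
  have hNE2 : NE2 ≤ N := le_trans (((le_max_left _ _).trans (le_max_left _ _)).trans (le_max_right _ _)) hN
  have hNS1 : NS1 ≤ N := le_trans (((le_max_right _ _).trans (le_max_left _ _)).trans (le_max_right _ _)) hN
  have hNS2 : NS2 ≤ N := le_trans (((le_max_left _ _).trans (le_max_right _ _)).trans (le_max_right _ _)) hN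
  have hNA' : NA ≤ N := le_trans (((le_max_right _ _).trans (le_max_right _ _)).trans (le_max_right _ _)) hN
  -- the goal is the crux's let-chain; it is the local Gibbs mean of `fullSum`
  change ∫⁻ z, ENNReal.ofReal |fullSum (Φ N) τ (rs N) g h z| ∂(localGibbsLaw σ a₀ u₀ θ₀ N (Φ N)) ≤
    ENNReal.ofReal δ
  set μ : Measure (Phase N) := localGibbsLaw σ a₀ u₀ θ₀ N (Φ N) with hμdef
  have hμν : μ ≪ localGibbsLaw σ (fun _ => 1) (fun _ => 0) (fun _ => 1) N (Φ N) :=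
    localGibbsLaw_absolutelyContinuous_localGibbsLaw continuous_const continuous_const
      continuous_const (fun _ => one_pos) (fun _ => one_pos) a₀ u₀ θ₀ hσ2 N (Φ N)
  have hμg : μ (Φ N).goodᶜ = 0 := localGibbsLaw_compl_good_eq_zero (Φ N)
  have hκμ : ∀ᵐ z ∂μ, ∀ i : Fin (N + 1), ∀ n : ℕ, |kappa (Φ N) (rs N) g i n z| ≤ Cg :=
    hμν.ae_le (ae_forall_abs_kappa_le (Φ N) (rs N) hCg)
  -- the cut weights
  set h' : Fin (N + 1) → ℕ → Past N → ℝ := fun i n p => if tN N / A ≤ p.2.2.2 - p.2.1 then h i n p else 0 with hh'def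
  have hrel : ∀ i n p, h' i n p = if tN N / A ≤ p.2.2.2 - p.2.1 then h i n p else 0 := fun _ _ _ => rfl
  obtain ⟨hh', hhb', hcut'⟩ := cut_admissible hh hhb hrel
  -- Step 1: the cut split
  set SF : Phase N → ℝ := fun z => hsDiameter σ N / ((N : ℝ) + 1) *
      ∑ i : Fin (N + 1), ∑ n ∈ Finset.range (cnt (Φ N) τ z i),
        (if (past (Φ N) (rs N) z i n).2.2.2 - (past (Φ N) (rs N) z i n).2.1 < tN N / A then (1 : ℝ) else 0)
    with hSF
  have hSF0 : ∀ z, 0 ≤ SF z := fun z => by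
    refine mul_nonneg (div_nonneg (hsDiameter_pos hσ N).le (by positivity)) (Finset.sum_nonneg fun i _ =>
      Finset.sum_nonneg fun n _ => ?_)
    split_ifs <;> norm_num
  have hSFae : AEMeasurable SF μ := aemeasurable_shortFn stub_pastMeasurable hσ (Φ N) τ (rs N) A hμg
  have hsplit : ∫⁻ z, ENNReal.ofReal |fullSum (Φ N) τ (rs N) g h z| ∂μ ≤
      ∫⁻ z, ENNReal.ofReal |fullSum (Φ N) τ (rs N) g h' z| ∂μ + ∫⁻ z, ENNReal.ofReal (2 * Cg * SF z) ∂μ := by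
    have hpt : ∀ᵐ z ∂μ, ENNReal.ofReal |fullSum (Φ N) τ (rs N) g h z| ≤
        ENNReal.ofReal |fullSum (Φ N) τ (rs N) g h' z| + ENNReal.ofReal (2 * Cg * SF z) := by
      filter_upwards [hκμ] with z hκz
      rw [← ENNReal.ofReal_add (abs_nonneg _) (mul_nonneg (by positivity) (hSF0 z))]
      refine ENNReal.ofReal_le_ofReal ?_
      have hd : |fullSum (Φ N) τ (rs N) g h z - fullSum (Φ N) τ (rs N) g h' z| ≤ 2 * Cg * SF z :=
        abs_fullSum_sub_cut_le (Φ N) hσ τ (rs N) hCg hhb hrel hκz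
      have htri : |fullSum (Φ N) τ (rs N) g h z| ≤ |fullSum (Φ N) τ (rs N) g h' z| +
          |fullSum (Φ N) τ (rs N) g h z - fullSum (Φ N) τ (rs N) g h' z| := by
        have := abs_add_le (fullSum (Φ N) τ (rs N) g h' z) (fullSum (Φ N) τ (rs N) g h z - fullSum (Φ N) τ (rs N) g h' z)
        rwa [add_sub_cancel] at this
      exact htri.trans (add_le_add_right hd _)
    calc ∫⁻ z, ENNReal.ofReal |fullSum (Φ N) τ (rs N) g h z| ∂μ
        ≤ ∫⁻ z, ENNReal.ofReal |fullSum (Φ N) τ (rs N) g h' z| + ENNReal.ofReal (2 * Cg * SF z) ∂μ :=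
          lintegral_mono_ae hpt
      _ = _ := lintegral_add_right' _ ((hSFae.const_mul (2 * Cg)).ennreal_ofReal)
  -- Step 2: the short-flight remainder (U)
  have hshort : ∫⁻ z, ENNReal.ofReal (2 * Cg * SF z) ∂μ ≤ ENNReal.ofReal (δ / 4) := by
    have h1 : ∫⁻ z, ENNReal.ofReal (2 * Cg * SF z) ∂μ = ENNReal.ofReal (2 * Cg) * ∫⁻ z, ENNReal.ofReal (SF z) ∂μ := by
      rw [← lintegral_const_mul'' _ hSFae.ennreal_ofReal]
      refine lintegral_congr fun z => ?_
      rw [← ENNReal.ofReal_mul hCg2]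
    rw [h1]
    calc ENNReal.ofReal (2 * Cg) * ∫⁻ z, ENNReal.ofReal (SF z) ∂μ
        ≤ ENNReal.ofReal (2 * Cg) * ENNReal.ofReal (δ / (8 * (Cg + 1))) := mul_le_mul_right (hUN N hNU) _
      _ = ENNReal.ofReal (2 * Cg * (δ / (8 * (Cg + 1)))) := by rw [← ENNReal.ofReal_mul (by positivity)]
      _ ≤ ENNReal.ofReal (δ / 4) := by
          refine ENNReal.ofReal_le_ofReal ?_
          rw [show 2 * Cg * (δ / (8 * (Cg + 1))) = (δ / 4) * (Cg / (Cg + 1)) by field_simp; ring]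
          have : Cg / (Cg + 1) ≤ 1 := (div_le_one (by positivity)).2 (by linarith)
          exact mul_le_of_le_one_right (by positivity) this
  -- Step 3: the core estimate for the cut family
  obtain ⟨hm0, hwin, hmtN, hmN⟩ := windows_count_facts hτ N
  set m : ℕ := ⌈τ / tN N⌉₊ with hmdef
  have hwlen : ∀ k, k < m → wEnd τ m (k + 1) ≤ wEnd τ m k + tN N := fun k hk => (window_facts hτ hm0 hwin hk).2.2.2
  have hfloor : ∀ (η' : ℝ) (z₀ : Phase N), η ≤ η' →
      ENNReal.ofReal (Real.exp (-(η * ((N : ℝ) + 1)))) ≤ μ (keyLevel N z₀) →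
      ENNReal.ofReal (Real.exp (-(η' * ((N : ℝ) + 1)))) ≤ μ (keyLevel N z₀) := by
    intro η' z₀ hη' hfl
    refine le_trans (ENNReal.ofReal_le_ofReal (Real.exp_le_exp.2 ?_)) hfl
    have hN0 : (0 : ℝ) ≤ (N : ℝ) + 1 := by positivity
    exact neg_le_neg (mul_le_mul_of_nonneg_right hη' hN0)
  have hRN' : ∀ k, k < m → ∀ z₀ : Phase N,
      ENNReal.ofReal (Real.exp (-(η * ((N : ℝ) + 1)))) ≤ μ (keyLevel N z₀) → _ :=
    fun k hk z₀ hfl =>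
      have hw := window_facts hτ hm0 hwin hk
      And.intro
        (hBN N hNB h' hh' hhb' hcut' (wEnd τ m k) (wEnd τ m (k + 1)) hw.1 hw.2.1 hw.2.2.1 hw.2.2.2 z₀
          (hfloor η₁ z₀ (min_le_left _ _) hfl))
        (hCN N hNC h' hh' hhb' hcut' (wEnd τ m k) (wEnd τ m (k + 1)) hw.1 hw.2.1 hw.2.2.1 hw.2.2.2 z₀
          (hfloor η₂ z₀ (min_le_right _ _) hfl))
  have hE2N' : localGibbsLaw σ (fun _ => 1) (fun _ => 0) (fun _ => θ₁) N (Φ N)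
      {z | K₀ * ((N : ℝ) + 1) < kinEnergy z} ≤ ENNReal.ofReal (Real.exp (-((Real.log Λ + 1) * ((N : ℝ) + 1)))) := by
    refine (measure_mono fun z hz => ?_).trans (hE2N N hNE2 σ hσ hσ12 (Φ N))
    simp only [mem_setOf_eq] at hz ⊢
    exact lt_of_le_of_lt (mul_le_mul_of_nonneg_right (le_max_left _ _) (by positivity)) hz
  obtain ⟨sN, hscard, hsN⟩ := hKCall N
  have core := cut_core_estimate stub_pastMeasurable hσ hσ2 (Φ N) ha hθ hu ha0 hθ0 hθ₁ hΛ (hdomAll σ hσ2 N) hτ hg hCg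
    hh' hhb' hA hcut' hE2N' hηp0 (fun z z' hzz' => hS1 N hNS1 σ z z' hzz') (fun z z' hzz' => hS2 N hNS2 σ z z' hzz')
    sN hsN hδ'0 hL0 hm0 hwlen hRN' le_rfl
  rw [hηpκ] at core
  -- Step 4: the arithmetic of the right-hand side
  have hε : hsDiameter σ N = σ * tN N := hsDiameter_eq_mul_tN σ N
  have hε0 : 0 ≤ hsDiameter σ N := (hsDiameter_pos hσ N).le
  have hβ0' : 0 ≤ 2 * Cg * (A + 1) * hsDiameter σ N :=
    mul_nonneg (mul_nonneg (mul_nonneg zero_le_two hCg0) (by linarith)) hε0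
  have htN0 := (tN_pos N).le
  have hmtN' : (m : ℝ) * tN N ≤ τ + 1 := hmtN
  have hm0R : (0 : ℝ) ≤ m := Nat.cast_nonneg m
  have hA1 : ∀ x : ℝ, 0 ≤ x → (m : ℝ) * (2 * Cg * (A + 1) * hsDiameter σ N) * x ≤ β₁ * x := by
    intro x hx
    refine mul_le_mul_of_nonneg_right ?_ hx
    rw [hε, hβ₁]
    calc (m : ℝ) * (2 * Cg * (A + 1) * (σ * tN N)) = 2 * Cg * (A + 1) * σ * ((m : ℝ) * tN N) := by ring
      _ ≤ 2 * Cg * (A + 1) * σ * (τ + 1) := mul_le_mul_of_nonneg_left hmtN' (by positivity)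
  have hT1 : (m : ℝ) * ((δ' + 1 / L) * tN N) ≤ δ / 4 := by
    calc (m : ℝ) * ((δ' + 1 / L) * tN N) = (δ' + 1 / L) * ((m : ℝ) * tN N) := by ring
      _ ≤ (δ' + 1 / L) * (τ + 1) := mul_le_mul_of_nonneg_left hmtN' (by positivity)
      _ = δ / 4 := by rw [← hbudget]; ring
  have hT2 : (m : ℝ) * (Real.exp (κ₁ * ((N : ℝ) + 1)) * (2 * Cg * (A + 1) * hsDiameter σ N + δ' * tN N) *
      Real.exp (-(c * ((N : ℝ) + 1)))) ≤
      (τ + 1) * (2 * Cg * (A + 1) * σ + δ') * (Real.exp (κ₁ * ((N : ℝ) + 1)) * Real.exp (-(c * ((N : ℝ) + 1)))) := by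
    rw [hε]
    have hx : 0 ≤ Real.exp (κ₁ * ((N : ℝ) + 1)) * Real.exp (-(c * ((N : ℝ) + 1))) := by positivity
    calc (m : ℝ) * (Real.exp (κ₁ * ((N : ℝ) + 1)) * (2 * Cg * (A + 1) * (σ * tN N) + δ' * tN N) *
          Real.exp (-(c * ((N : ℝ) + 1))))
        = ((m : ℝ) * tN N) * (2 * Cg * (A + 1) * σ + δ') *
            (Real.exp (κ₁ * ((N : ℝ) + 1)) * Real.exp (-(c * ((N : ℝ) + 1)))) := by ring
      _ ≤ (τ + 1) * (2 * Cg * (A + 1) * σ + δ') *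
            (Real.exp (κ₁ * ((N : ℝ) + 1)) * Real.exp (-(c * ((N : ℝ) + 1)))) :=
          mul_le_mul_of_nonneg_right (mul_le_mul_of_nonneg_right hmtN' (by positivity)) hx
  have hT3 : (sN.card : ℝ) * ((m : ℝ) * (2 * Cg * (A + 1) * hsDiameter σ N) * Real.exp (-(η * ((N : ℝ) + 1)))) ≤
      Real.exp (CK * ((N : ℝ) + 1) ^ (3 / 4 : ℝ) * Real.log ((N : ℝ) + 2)) * (β₁ * Real.exp (-(η * ((N : ℝ) + 1)))) :=
    mul_le_mul hscard (hA1 _ (Real.exp_pos _).le) (mul_nonneg (mul_nonneg hm0R hβ0') (Real.exp_pos _).le)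
      (Real.exp_pos _).le
  have hT4 : (m : ℝ) * (2 * Cg * (A + 1) * hsDiameter σ N) * Real.exp (-((N : ℝ) + 1)) ≤ β₁ * Real.exp (-((N : ℝ) + 1)) :=
    hA1 _ (Real.exp_pos _).le
  have hAll := hNA N hNA'
  have hsum : (m : ℝ) * ((δ' + 1 / L) * tN N) +
      (m : ℝ) * (Real.exp (κ₁ * ((N : ℝ) + 1)) * (2 * Cg * (A + 1) * hsDiameter σ N + δ' * tN N) *
        Real.exp (-(c * ((N : ℝ) + 1)))) +
      (sN.card : ℝ) * ((m : ℝ) * (2 * Cg * (A + 1) * hsDiameter σ N) * Real.exp (-(η * ((N : ℝ) + 1)))) +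
      (m : ℝ) * (2 * Cg * (A + 1) * hsDiameter σ N) * Real.exp (-((N : ℝ) + 1)) ≤ δ / 4 + δ / 4 := by
    have h1 := add_le_add (add_le_add (add_le_add hT1 hT2) hT3) hT4
    have h2 := add_le_add_right hAll (δ / 4)
    refine h1.trans (le_of_eq_of_le ?_ h2)
    simp only [add_assoc]
  have hpos1 : 0 ≤ (m : ℝ) * ((δ' + 1 / L) * tN N) :=
    mul_nonneg hm0R (mul_nonneg (add_nonneg hδ'0.le (by positivity)) htN0)
  have hpos2 : 0 ≤ (m : ℝ) * (Real.exp (κ₁ * ((N : ℝ) + 1)) * (2 * Cg * (A + 1) * hsDiameter σ N + δ' * tN N) *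
      Real.exp (-(c * ((N : ℝ) + 1)))) :=
    mul_nonneg hm0R (mul_nonneg (mul_nonneg (Real.exp_pos _).le (add_nonneg hβ0' (mul_nonneg hδ'0.le htN0)))
      (Real.exp_pos _).le)
  have hpos3 : 0 ≤ (sN.card : ℝ) * ((m : ℝ) * (2 * Cg * (A + 1) * hsDiameter σ N) *
      Real.exp (-(η * ((N : ℝ) + 1)))) :=
    mul_nonneg (Nat.cast_nonneg _) (mul_nonneg (mul_nonneg hm0R hβ0') (Real.exp_pos _).le)
  have hpos4 : 0 ≤ (m : ℝ) * (2 * Cg * (A + 1) * hsDiameter σ N) * Real.exp (-((N : ℝ) + 1)) :=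
    mul_nonneg (mul_nonneg hm0R hβ0') (Real.exp_pos _).le
  have hcore' : ∫⁻ z, ENNReal.ofReal |fullSum (Φ N) τ (rs N) g h' z| ∂μ ≤ ENNReal.ofReal (δ / 4 + δ / 4) := by
    refine core.trans ?_
    rw [← ENNReal.ofReal_add hpos1 hpos2, ← ENNReal.ofReal_add (add_nonneg hpos1 hpos2) hpos3,
      ← ENNReal.ofReal_add (add_nonneg (add_nonneg hpos1 hpos2) hpos3) hpos4]
    exact ENNReal.ofReal_le_ofReal hsum
  calc ∫⁻ z, ENNReal.ofReal |fullSum (Φ N) τ (rs N) g h z| ∂μ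
      ≤ ENNReal.ofReal (δ / 4 + δ / 4) + ENNReal.ofReal (δ / 4) := hsplit.trans (add_le_add hcore' hshort)
    _ = ENNReal.ofReal (δ / 4 + δ / 4 + δ / 4) := by rw [← ENNReal.ofReal_add (by positivity) (by positivity)]
    _ ≤ ENNReal.ofReal δ := ENNReal.ofReal_le_ofReal (by linarith)

end Summit.AtomisticToContinuum.HydrodynamicLimit.Theorems.KickFairRelEquilibriumMesoLine

end
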